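import Summits.Parity.GeneralizedHardyLittlewood.Theorems.LeeYangFibresRelativeDimOneSplitDefs
import Summits.Parity.GeneralizedHardyLittlewood.Theorems.LeeYangFibresRelativeDimOneLocalAverage
import HarnessLib

/-!
# Translation invariance of incidence types, band sums and local factors (crux stmt-Parity-14113
`LeeYangFibres.RelativeDimOne`, line gallagher-backwards-split, stub `stub_inversion`, PIECE 2)

The reparametrisation `n ↦ n + m` of the `d = 1` system `ψ_i(n) = a_i n + b_i` replaces the shift
vector `b` by `b + m a`. We prove that it leaves invariant
* the incidence types `incType q a b` (`incType_translate`): `gcd(b_i + m a_i, g) = gcd(b_i, g)` for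
  `g = gcd(a_i, q) ∣ a_i`, and `a_i (b_j + m a_j) − a_j (b_i + m a_i) = a_i b_j − a_j b_i`;
  hence every band sum `bandSum Q e a b` (`bandSum_translate`, the registered
  `bandSum_translate_invariant`);
* every local factor `β_q` (`localFactor_sys_translate`: `c ↦ c + m` permutes the residues mod `q` and
  the integrand is `q`-periodic), hence the partial singular products and the singular series
  (`singularProduct_sys_translate`);
* non-degeneracy (`isNondegenerateSystem_sys_iff`: `sys a b` is non-degenerate iff all `a_i ≠ 0` and
  all discriminants `a_i b_j − a_j b_i`, `i ≠ j`, are non-zero; `isNondegenerateSystem_sys_translate`).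
-/

noncomputable section

open scoped BigOperators Classical Topology
open Finset Filter MeasureTheory Literature.NumberTheory.Sieve
open Summit.Parity.GeneralizedHardyLittlewood.Cruxes.RelativeDimOne.TranslateAmplification
  (localFactor_fin_one prod_localVonMangoldt_congr)

namespace Summit.Parity.GeneralizedHardyLittlewood.Cruxes.RelativeDimOne.GallagherBackwardsSplit

variable {t : ℕ}

/-! ### Incidence types and band sums -/

/-- `gcd(b + c g', g) = gcd(b, g)` whenever `g ∣ g'` (integers, `Int.gcd`). -/
theorem int_gcd_add_mul_of_dvd (b c g' : ℤ) (g : ℕ) (h : (g : ℤ) ∣ g') :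
    Int.gcd (b + c * g') g = Int.gcd b g := by
  obtain ⟨k, hk⟩ := h
  rw [← Int.gcd_emod, hk, show b + c * (g * k) = b + (c * k) * g by ring, Int.add_mul_emod_self_right,
    Int.gcd_emod]

/-- The incidence type is invariant under `b ↦ b + m a`. -/
theorem incType_translate (q : ℕ) (a b : Fin t → ℤ) (m : ℤ) :
    incType q a (fun i => b i + m * a i) = incType q a b := by
  unfold incType
  refine Prod.ext ?_ ?_
  · funext i
    refine Prod.ext rfl ?_
    dsimp only
    exact int_gcd_add_mul_of_dvd (b i) m (a i) (Int.gcd (a i) q) (Int.gcd_dvd_left _ _)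
  · funext i j
    dsimp only
    congr 1
    ring

/-- Band sums of incidence spectra are invariant under `b ↦ b + m a`. -/
theorem bandSum_translate (Q : ℕ) (e : ℕ → (Fin t → ℤ) → IncType t → ℝ) (a b : Fin t → ℤ) (m : ℤ) :
    bandSum Q e a (fun i => b i + m * a i) = bandSum Q e a b := by
  unfold bandSum
  refine Finset.sum_congr rfl fun q _ => ?_
  rw [incType_translate]

/-- Registered form of `bandSum_translate` (aux for `stub_inversion`). -/
theorem bandSum_translate_invariant : ∀ {t : ℕ} (Q : ℕ) (e : ℕ → (Fin t → ℤ) → IncType t → ℝ) (a b : Fin t → ℤ) (m : ℤ), bandSum Q e a (fun i => b i + m * a i) = bandSum Q e a b := by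
  intro t Q e a b m
  exact bandSum_translate Q e a b m

/-! ### Evaluations and size of `sys a b` and of its translate -/

/-- The translate evaluates as `ψ_i(n + m)`. -/
theorem sys_translate_eval (a b : Fin t → ℤ) (m : ℤ) (i : Fin t) (n : Fin 1 → ℤ) :
    (sys a (fun i => b i + m * a i) i).eval n = (sys a b i).eval (fun j => n j + m) := by
  simp only [sys, AffLinForm.eval, Fin.sum_univ_one]
  ring

/-- `‖sys a b‖_N = Σ_i |a_i| + Σ_i |b_i / N|`. -/
theorem affLinSize_sys (a b : Fin t → ℤ) (N : ℝ) :
    affLinSize (sys a b) N = ∑ i, |(a i : ℝ)| + ∑ i, |(b i : ℝ) / N| := by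
  simp [affLinSize, sys]

/-! ### Local factors and the singular series -/

/-- For `q ≥ 1`, `((x % q).toNat : ℤ) = x % q`. -/
theorem toNat_emod_cast {q : ℕ} (hq : 0 < q) (x : ℤ) : (((x % (q : ℤ)).toNat : ℕ) : ℤ) = x % q :=
  Int.toNat_of_nonneg (Int.emod_nonneg x (by exact_mod_cast hq.ne'))

/-- For `q ≥ 1`, `(x % q).toNat < q`. -/
theorem toNat_emod_lt {q : ℕ} (hq : 0 < q) (x : ℤ) : (x % (q : ℤ)).toNat < q := by
  have h1 : x % (q : ℤ) < q := Int.emod_lt_of_pos x (by exact_mod_cast hq)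
  have h2 : 0 ≤ x % (q : ℤ) := Int.emod_nonneg x (by exact_mod_cast hq.ne')
  omega

/-- A complete residue sum of a `q`-periodic function on `ℤ` is invariant under an integer shift:
`Σ_{c<q} F(c + m) = Σ_{c<q} F(c)`. -/
theorem sum_range_intCast_add_of_modEq {M : Type*} [AddCommMonoid M] {q : ℕ} (hq : 0 < q)
    (F : ℤ → M) (hF : ∀ x y : ℤ, x ≡ y [ZMOD q] → F x = F y) (m : ℤ) :
    ∑ c ∈ range q, F ((c : ℤ) + m) = ∑ c ∈ range q, F (c : ℤ) := by
  refine Finset.sum_nbij' (fun c : ℕ => (((c : ℤ) + m) % (q : ℤ)).toNat)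
    (fun c : ℕ => (((c : ℤ) - m) % (q : ℤ)).toNat) ?_ ?_ ?_ ?_ ?_
  · intro c _
    exact Finset.mem_range.2 (toNat_emod_lt hq _)
  · intro c _
    exact Finset.mem_range.2 (toNat_emod_lt hq _)
  · intro c hc
    rw [Finset.mem_range] at hc
    have h1 : (((((c : ℤ) + m) % (q : ℤ)).toNat : ℕ) : ℤ) - m ≡ (c : ℤ) [ZMOD q] := by
      rw [toNat_emod_cast hq]
      have := (Int.emod_emod_of_dvd ((c : ℤ) + m) (dvd_refl (q : ℤ)))
      calc ((c : ℤ) + m) % q - m ≡ ((c : ℤ) + m) - m [ZMOD q] := (Int.mod_modEq _ _).sub_right _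
        _ = c := by ring
        _ ≡ c [ZMOD q] := Int.ModEq.refl _
    have h2 : ((((((c : ℤ) + m) % (q : ℤ)).toNat : ℕ) : ℤ) - m) % q = (c : ℤ) := by
      rw [h1.eq]
      exact Int.emod_eq_of_lt (by exact_mod_cast Nat.zero_le c) (by exact_mod_cast hc)
    have h3 : (((((((c : ℤ) + m) % (q : ℤ)).toNat : ℕ) : ℤ) - m) % q).toNat = c := by
      rw [h2, Int.toNat_natCast]
    exact h3
  · intro c hc
    rw [Finset.mem_range] at hc
    have h1 : (((((c : ℤ) - m) % (q : ℤ)).toNat : ℕ) : ℤ) + m ≡ (c : ℤ) [ZMOD q] := by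
      rw [toNat_emod_cast hq]
      calc ((c : ℤ) - m) % q + m ≡ ((c : ℤ) - m) + m [ZMOD q] := (Int.mod_modEq _ _).add_right _
        _ = c := by ring
        _ ≡ c [ZMOD q] := Int.ModEq.refl _
    have h2 : ((((((c : ℤ) - m) % (q : ℤ)).toNat : ℕ) : ℤ) + m) % q = (c : ℤ) := by
      rw [h1.eq]
      exact Int.emod_eq_of_lt (by exact_mod_cast Nat.zero_le c) (by exact_mod_cast hc)
    have h3 : (((((((c : ℤ) - m) % (q : ℤ)).toNat : ℕ) : ℤ) + m) % q).toNat = c := by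
      rw [h2, Int.toNat_natCast]
    exact h3
  · intro c _
    refine hF _ _ ?_
    rw [toNat_emod_cast hq]
    exact (Int.mod_modEq _ _).symm

/-- Every local factor is invariant under `b ↦ b + m a` (`n ↦ n + m` permutes `ℤ/qℤ`). -/
theorem localFactor_sys_translate (a b : Fin t → ℤ) (m : ℤ) (q : ℕ) :
    localFactor (sys a (fun i => b i + m * a i)) q = localFactor (sys a b) q := by
  rw [localFactor_fin_one, localFactor_fin_one]
  congr 1
  rcases Nat.eq_zero_or_pos q with hq | hq
  · subst hq
    simp
  have hF : ∀ x y : ℤ, x ≡ y [ZMOD q] →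
      (∏ i, localVonMangoldt q ((sys a b i).eval fun _ => x)) =
        ∏ i, localVonMangoldt q ((sys a b i).eval fun _ => y) :=
    fun x y h => prod_localVonMangoldt_congr (sys a b) h
  rw [← sum_range_intCast_add_of_modEq hq _ hF m]
  refine Finset.sum_congr rfl fun c _ => ?_
  refine Finset.prod_congr rfl fun i _ => ?_
  rw [sys_translate_eval]

/-- The partial singular products are invariant under `b ↦ b + m a`. -/
theorem singularProductPartial_sys_translate (a b : Fin t → ℤ) (m : ℤ) :
    singularProductPartial (sys a (fun i => b i + m * a i)) = singularProductPartial (sys a b) := by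
  funext x
  unfold singularProductPartial
  exact Finset.prod_congr rfl fun p _ => localFactor_sys_translate a b m p

/-- The singular series is invariant under `b ↦ b + m a`. -/
theorem singularProduct_sys_translate (a b : Fin t → ℤ) (m : ℤ) :
    singularProduct (sys a (fun i => b i + m * a i)) = singularProduct (sys a b) := by
  unfold singularProduct
  rw [singularProductPartial_sys_translate]

/-- The local type factor of a coset only depends on the residues: trivially invariant in the same way. -/
theorem localTypeFactor_translate (q : ℕ) (a c : Fin t → ℤ) (m : ℤ) :
    localTypeFactor q a (fun i => c i + m * a i) = localTypeFactor q a c := by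
  unfold localTypeFactor
  exact Finset.prod_congr rfl fun p _ => localFactor_sys_translate a c m p

/-! ### Non-degeneracy -/

/-- `sys a b` is non-degenerate iff every `a_i ≠ 0` and every discriminant `a_i b_j − a_j b_i`
(`i ≠ j`) is non-zero. -/
theorem isNondegenerateSystem_sys_iff (a b : Fin t → ℤ) :
    IsNondegenerateSystem (sys a b) ↔ (∀ i, a i ≠ 0) ∧ ∀ i j, i ≠ j → a i * b j ≠ a j * b i := by
  have hcoeff : ∀ i, ((sys a b i).coeff ≠ 0 ↔ a i ≠ 0) := by
    intro i
    constructor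
    · intro h ha
      apply h
      funext j
      simpa [sys] using ha
    · intro h hc
      apply h
      have := congrFun hc 0
      simpa [sys] using this
  constructor
  · rintro ⟨h1, h2⟩
    refine ⟨fun i => (hcoeff i).1 (h1 i), fun i j hij hD => ?_⟩
    have hai : a i ≠ 0 := (hcoeff i).1 (h1 i)
    have haj : a j ≠ 0 := (hcoeff j).1 (h1 j)
    have key := h2 i j hij (a j) (a i) (fun n => by
      simp only [sys, AffLinForm.eval, Fin.sum_univ_one]
      linear_combination (-1 : ℤ) * hD)
    exact haj key.1
  · rintro ⟨h1, h2⟩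
    refine ⟨fun i => (hcoeff i).2 (h1 i), fun i j hij la mu h => ?_⟩
    have e0 := h (fun _ => 0)
    have e1 := h (fun _ => 1)
    simp only [sys, AffLinForm.eval, Fin.sum_univ_one, mul_zero, zero_add, mul_one] at e0 e1
    -- `la * b i = mu * b j`, `la * (a i + b i) = mu * (a j + b j)` ⇒ `la * a i = mu * a j`
    have ea : la * a i = mu * a j := by linear_combination e1 - e0
    have hD := h2 i j hij
    have hla : la = 0 := by
      by_contra hne
      apply hD
      have : la * (a i * b j - a j * b i) = 0 := by linear_combination (b j) * ea - (a j) * e0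
      rcases mul_eq_zero.1 this with h0 | h0
      · exact absurd h0 hne
      · linear_combination h0
    refine ⟨hla, ?_⟩
    rw [hla, zero_mul] at ea
    rcases mul_eq_zero.1 ea.symm with h0 | h0
    · exact h0
    · exact absurd h0 (h1 j)

/-- Non-degeneracy is invariant under `b ↦ b + m a`. -/
theorem isNondegenerateSystem_sys_translate (a b : Fin t → ℤ) (m : ℤ) :
    IsNondegenerateSystem (sys a (fun i => b i + m * a i)) ↔ IsNondegenerateSystem (sys a b) := by
  rw [isNondegenerateSystem_sys_iff, isNondegenerateSystem_sys_iff]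
  refine and_congr Iff.rfl (forall_congr' fun i => forall_congr' fun j => imp_congr_right fun _ => ?_)
  rw [not_iff_not]
  constructor
  · intro h; linear_combination h
  · intro h; linear_combination h

/-- The coset condition is invariant under the simultaneous translation of `b` and `c`. -/
theorem modEq_translate_iff (q : ℕ) (a b c : Fin t → ℤ) (m : ℤ) (i : Fin t) :
    Int.ModEq q (b i + m * a i) (c i + m * a i) ↔ Int.ModEq q (b i) (c i) :=
  ⟨fun h => by simpa using h.sub_right (m * a i), fun h => h.add_right _⟩

end Summit.Parity.GeneralizedHardyLittlewood.Cruxes.RelativeDimOne.GallagherBackwardsSplit
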